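import Summits.ResolutionOfSingularities.ResolutionOfSingularities.Theorems.HomologicalConductorNoZenoBirthDefs
import Summits.ResolutionOfSingularities.ResolutionOfSingularities.Theorems.HomologicalConductorNoZenoTowerNoetherian
import Summits.ResolutionOfSingularities.ResolutionOfSingularities.Theorems.HomologicalConductorNoZenoNoetherianCase
import Literature.RingTheory.CohomologyAnnihilator.AnnihilationOfCohomology
import Literature.AlgebraicGeometry.Resolution.AffineDomainDimension
import HarnessLib

/-!
# Crux `NoZeno` (stmt-ResolutionOfSingularities-16483), line `birth`: `stub_unitOfRegularCentre`

Route `ResolutionOfSingularities/HomologicalConductor`, crux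
`Summit.ResolutionOfSingularities.ResolutionOfSingularities.Theses.HomologicalConductor.NoZeno`.
Registered stub of the line `birth` (skeleton v4):

  if the centre `𝔭` on a stage `T_m = tower O A m` of an overring `U ≥ O` (the prime of the
  `x ∈ T_m` that are non-units of `U`) has regular local ring `(T_m)_𝔭`, then some nonzero
  element of `ca(T_m)` is a unit of `U` — GIVEN Iyengar–Takahashi's Theorem 5.4
  (`Literature.RingTheory.CohomologyAnnihilator.singEqVCa_essFiniteType`, taken as a hypothesis).

Proof: `T_m` is essentially of finite type over `k` (`tn_tower_invariant`), i.e. the localisation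
of its finitely generated subalgebra `A' = k[s₁, …, s_r]` (`Algebra.EssFiniteType.subalgebra`,
`Algebra.EssFiniteType.isLocalization`) at the elements invertible in `T_m`; `A'` is an affine
domain, of some Krull dimension `d` (`exists_ringKrullDim_eq_and_trdeg_eq`). Theorem 5.4 at the
prime `𝔭` of the localisation `T_m` reads `ca(T_m) ≤ 𝔭 ↔ (T_m)_𝔭 not regular`, so regularity
yields `c ∈ ca(T_m) = cohomologyAnnihilator T_m` (`ca_eq_cohomologyAnnihilator`) with `c ∉ 𝔭`;
then `(c : K) ∈ ca (tower O A m)` (`tn_coe_mem_ca_iff`) and `(c : K) ∉ U.nonunits`, i.e.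
`c ≠ 0 ∧ c⁻¹ ∈ U` (`ValuationSubring.mem_nonunits_iff_or`).
-/

noncomputable section

-- single-problem summit: the doubled namespace component `ResolutionOfSingularities` is forced
set_option linter.dupNamespace false

namespace Summit.ResolutionOfSingularities.ResolutionOfSingularities.Theorems.NoZeno.Birth

open Summit.ResolutionOfSingularities.ResolutionOfSingularities.Theses.HomologicalConductor

open Literature.AlgebraicGeometry.Resolution Literature.RingTheory.CohomologyAnnihilator

/-! ## The registered stub -/

/-- **STUB `stub_unitOfRegularCentre` (line `birth` of crux `NoZeno`, v4).** Given
Iyengar–Takahashi's Theorem 5.4 (`singEqVCa_essFiniteType`): if the centre `𝔭` of an overring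
`U ≥ O` on a stage `T_m = tower O A m` has regular local ring `(T_m)_𝔭`, some nonzero element of
`ca(T_m)` is a unit of `U`. `T_m` is essentially of finite type over `k` (`tn_tower_invariant`),
i.e. a localisation of a finitely generated subalgebra `A' = k[s₁, …, s_r] ⊆ T_m`
(`Algebra.EssFiniteType`), an affine domain of some Krull dimension `d`
(`exists_ringKrullDim_eq_and_trdeg_eq`); Theorem 5.4 at the prime `𝔭` gives
`ca(T_m) ≤ 𝔭 ↔ ¬ regular (T_m)_𝔭`, so regularity yields `c ∈ cohomologyAnnihilator T_m`, `c ∉ 𝔭`;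
then `(c : K) ∈ ca (tower O A m)` (`tn_coe_mem_ca_iff`) and `(c : K) ∉ U.nonunits`, i.e.
`c ≠ 0 ∧ c⁻¹ ∈ U` (`ValuationSubring.mem_nonunits_iff_or`).
[cite: IyengarTakahashi2014, Thm. 5.4] -/
theorem stub_unitOfRegularCentre
    (h54 : Literature.RingTheory.CohomologyAnnihilator.singEqVCa_essFiniteType.{0})
    (k K : Type) [Field k] [Field K] [Algebra k K] (O : ValuationSubring K) (A : Subalgebra k K)
    (hk : ∀ c : k, algebraMap k K c ∈ O) (hA : A.FG) (hfr : IsFractionRing ↥A K)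
    (hAO : A.toSubring ≤ O.toSubring) (U : ValuationSubring K) (hOU : O ≤ U) (m : ℕ)
    (𝔭 : Ideal ↥(tower O A m)) [𝔭.IsPrime] (h𝔭 : ∀ x : ↥(tower O A m), x ∈ 𝔭 ↔ (x : K) ∈ U.nonunits)
    (hreg : IsRegularLocalRing (Localization.AtPrime 𝔭)) :
    ∃ c ∈ ca (tower O A m), c ≠ 0 ∧ c⁻¹ ∈ U := by
  -- `T_m` lies in `O ≤ U` and is essentially of finite type over `k`
  obtain ⟨-, hTO, hET⟩ := tn_tower_invariant O A hk hA hfr hAO m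
  haveI := hET
  -- the finitely generated model `A' = k[s₁, …, s_r] ⊆ T_m` of which `T_m` is a localisation
  obtain ⟨d, hd, -⟩ := exists_ringKrullDim_eq_and_trdeg_eq k
    ↥(Algebra.EssFiniteType.subalgebra k ↥(tower O A m))
  -- Theorem 5.4 at the prime `𝔭` of the localisation `T_m`
  have key : Literature.RingTheory.CohomologyAnnihilator.ca ↥(tower O A m) ≤ 𝔭 ↔
      ¬ IsRegularLocalRing (Localization.AtPrime 𝔭) :=
    (h54 k ↥(Algebra.EssFiniteType.subalgebra k ↥(tower O A m)) inferInstance d hd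
      (Algebra.EssFiniteType.submonoid k ↥(tower O A m)) ↥(tower O A m) inferInstance 𝔭).1
  have hnot : ¬ Literature.RingTheory.CohomologyAnnihilator.ca ↥(tower O A m) ≤ 𝔭 :=
    fun h => key.mp h hreg
  obtain ⟨c, hc, hc𝔭⟩ := SetLike.not_le_iff_exists.mp hnot
  rw [ca_eq_cohomologyAnnihilator] at hc
  -- `c ∈ T_m ⊆ O ≤ U`, and `c ∉ 𝔭` means `(c : K)` is a unit of `U`
  have hcU : (c : K) ∈ U ∧ (c : K) ∉ U.nonunits :=
    ⟨hOU (hTO (Subalgebra.mem_toSubring.mpr c.2)), fun h => hc𝔭 ((h𝔭 c).mpr h)⟩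
  rw [ValuationSubring.mem_nonunits_iff_or, not_or, not_not] at hcU
  exact ⟨c, (tn_coe_mem_ca_iff (tower O A m) c).mpr hc, hcU.2.1, hcU.2.2⟩

end Summit.ResolutionOfSingularities.ResolutionOfSingularities.Theorems.NoZeno.Birth

end
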